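import Summits.BirchSwinnertonDyer.BirchSwinnertonDyer.Theses.RamifiedHeegnerPair
import Summits.BirchSwinnertonDyer.BirchSwinnertonDyer.Theorems.RamifiedHeegnerPairRamifiedPairUpperBoundOfUpperHalfOverK
import Summits.BirchSwinnertonDyer.Rank1Residual.Additive.QuadraticTwistBSDComparisonIsogeny
import Literature.NumberTheory.EllipticCurves.Rank1Residual.Typed.Basic
import HarnessLib

/-!
# Route `RamifiedHeegnerPair`, crux X1 `RamifiedPairLowerBound` (stmt-BirchSwinnertonDyer-23191), line `birth` v3 —
# the crux BY NAME from the `ℚ`-side LOWER HALVES of its two members, split by the analytic rank of the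
# ADDITIVE member, and its reduction to the INTRINSIC Gss2 classes at `3`

HONEST FRAMING. Theorems only; helper file (`--supports stmt-BirchSwinnertonDyer-23191`), pure bookkeeping over
DISPLAYED hypotheses; it credits nothing toward closing the item and BSD is not proved by any of this. No new
definition, no new named fact, no restatement of the crux (the route decl is concluded BY NAME).

WHAT. X1 asks, for every non-CM globally minimal `W` additive of class Gss2 at `3` (`Addv W 3 ∧ SubGss W 3`:
`W = V₁ ⊗ χ₋₃` with `V₁` good supersingular at `3`), every 3-ramified twist partner `V` (a globally minimal model
of `W^{(d)}`, `d < 0`, `v₃(d) = 1`, GOOD supersingular at `3`) with `r_an(W) + r_an(V) = 1`, the PAIR inequality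
`ord₃ Ш_an(W) + ord₃ Ш_an(V) ≤ ord₃ #Ш(W) + ord₃ #Ш(V)`. In the tree's one-sided currency
`Typed.MissingLowerBoundAt E 3 := ∃ q, Ш_an(E) = q ∧ ord₃ q ≤ ord₃ #Ш(E)` this is the SUM of the lower halves of
the two members, so:

* §1 `pairLowerBoundAt_of_missingLowerBoundAt` — pointwise: the two members' lower halves give X1's conclusion at
  `(W, V)`; `ramifiedPairLowerBound_of_missingLowerBoundAt` — X1 BY NAME from the lower half on the non-CM Gss2 leaf
  (`r_an ≤ 1`) and on the non-CM GOOD-supersingular-at-`3` curves of analytic rank `≤ 1` (twin of rhp-p2's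
  `RamifiedPairUpperBound.ramifiedPairUpperBound_of_missingUpperBoundAt`, p601388);
* §2 the ORIENTATION SPLIT, which is the composition of the line's skeleton v3: X1 BY NAME from THREE statements —
  (L₀) the lower half on the Gss2 leaf in analytic rank `0` [Kato's main conjecture 12.10 for `(f_W, 3)` at an
  ADDITIVE `3`; announced on the Fouquet–Wan locus, arXiv:2107.13726 Thm. 5.1 / Cor. 5.4 (PRE), nothing in print
  off it], (L₁) the same in analytic rank `1` [a `3`-adic Gross–Zagier formula on the `ω`-branch / the signed
  anticyclotomic main conjecture `⊇` over the 3-RAMIFIED `K = ℚ(√d)`; nothing in print], (L_V) the lower half for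
  the non-CM good-supersingular-at-`3` partner in analytic rank `≤ 1` — which is HALF OF THE ROUTE'S OWN RESIDUAL
  `GoodSupersingularAtThree` (item 23193, bound as `hR` in `closes`): `goodSSLowerAtThree_of_goodSupersingularAtThree`
  derives it from that item and GZK, so `ramifiedPairLowerBound_of_gssLowerHalves_of_goodSupersingularAtThree`
  gives X1 from (L₀), (L₁), GZK and the residual the route already carries;
* §3 CASSELS TRANSPORT to the INTRINSIC classes: the lower half is free when `ord₃ Ш_an ≤ 0`
  (`N10.missingLowerBoundAt_of_padicValRat_le_zero`) and is a `ℚ`-isogeny invariant in analytic rank `≤ 1`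
  (Cassels + GZK + modularity: the tree's `TwistComparison.missingLowerBoundAt_of_isIsogenous`; same three lines as
  route TQS's `SolventPairLowerBound.missingLowerBoundAt_of_isIsogenous_unitMember_of_analyticRank_le_one`, whose module
  is not imported here only to keep this file's import cone inside this route), so (L₀)/(L₁) follow from the lower
  half on the Gss2 curves ALL of whose globally minimal class members have
  `ord₃ Ш_an > 0` (`gssLowerAtThree_of_intrinsicRows`), and X1 BY NAME from those rows
  (`ramifiedPairLowerBound_of_intrinsicRows_of_goodSupersingularAtThree`). Census reading (instrument, not proof;
  `pub/bsd-wall/bsd-wall-census/ROW2-AT3-SUBBLOCKS-v1.md` Table 4, Cremona `allbsd` N < 5·10⁵): Gss2 at `3` =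
  1 060 classes; rank `0`: 705, of which 366 intrinsic; rank `1`: 355, of which 9 intrinsic (rank-one `#Ш_an` is
  a numerical reading);
* §4 the reshape is LOSSLESS modulo the route's own items: X1, the twist supply (item 25113, CLOSED modulo the
  displayed print inputs 25112) and `BSD₃` of the partner (the residual 23193) give back the lower half on the whole
  Gss2 leaf (`gssLowerAtThree_of_ramifiedPairLowerBound`), because `BSD₃(V)` makes the partner's term exact.

Dictionary with the line's v2 (rhp-p1 g0): v2's load-bearing stub «LowerHalfOverK» (the lower half of `BSD₃(W_K/K)`,
`K = ℚ(√d)`) is EQUIVALENT to X1 modulo the displayed published inputs (p598811 + p600026; pointwise p604713), and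
X1 at `(W, V)` is the sum (L_W) + (L_V) of this file: over `K` the Heegner-point statement packages BOTH ranks of the
additive member at once; over `ℚ` they separate, and only the rank-`0` one has an announced engine.

References: J. W. S. Cassels, J. reine angew. Math. 217 (1965); J. S. Milne, *Arithmetic Duality Theorems* (2006)
Thm. I.7.3; R. L. Miller, LMS J. Comput. Math. 14 (2011) Def. 1.1; B. Gross, D. Zagier, Invent. Math. 84 (1986);
V. A. Kolyvagin, Progr. Math. 87 (1990); O. Fouquet, X. Wan, arXiv:2107.13726 Thm. 5.1 / Cor. 5.4 (claim, cited
for orientation only; nothing of it is used here).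
-/

-- D-0017: single-problem summit, so `Summit.BirchSwinnertonDyer.BirchSwinnertonDyer.…` repeats a namespace BY DESIGN.
set_option linter.dupNamespace false
set_option autoImplicit false

noncomputable section

open scoped Classical

open WeierstrassCurve Literature.NumberTheory.EllipticCurves Literature.NumberTheory.EllipticCurves.ModularForms
  Literature.NumberTheory.EllipticCurves.Rank1Residual Literature.NumberTheory.EllipticCurves.Rank1Residual.Typed
  Summit.BirchSwinnertonDyer.Rank1Residual.Additive Summit.BirchSwinnertonDyer.Rank1Residual
  Summit.BirchSwinnertonDyer.BirchSwinnertonDyer.Theses.RamifiedHeegnerPair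

namespace Summit.BirchSwinnertonDyer.BirchSwinnertonDyer.Theorems.RamifiedPairLowerBound

/-! ## §1 The pair inequality from the two members' lower halves -/

/-- **Pointwise bookkeeping.** If `Ш_an(W) = q` with `ord₃ q ≤ ord₃ #Ш(W)` and `Ш_an(V) = q'` with
`ord₃ q' ≤ ord₃ #Ш(V)` (the two members' `Typed.MissingLowerBoundAt · 3`), then X1's conclusion holds at `(W, V)`:
`Ш_an(W)`, `Ш_an(V)` are rationals with `ord₃ q + ord₃ q' ≤ ord₃ #Ш(W) + ord₃ #Ш(V)`. [folklore] -/
theorem pairLowerBoundAt_of_missingLowerBoundAt (W V : WeierstrassCurve ℚ) [W.IsElliptic] [V.IsElliptic]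
    (hW : MissingLowerBoundAt W 3) (hV : MissingLowerBoundAt V 3) :
    ∃ q q' : ℚ, shaAn W = (q : ℂ) ∧ shaAn V = (q' : ℂ) ∧
      padicValRat 3 q + padicValRat 3 q' ≤ (padicValNat 3 W.shaOrder : ℤ) + (padicValNat 3 V.shaOrder : ℤ) := by
  obtain ⟨q, hq, hleW⟩ := hW
  obtain ⟨q', hq', hleV⟩ := hV
  exact ⟨q, q', hq, hq', by linarith⟩

/-- **`RamifiedPairLowerBound` from the members' main-conjecture halves over `ℚ`** (pure bookkeeping, no published
input; twin of `RamifiedPairUpperBound.ramifiedPairUpperBound_of_missingUpperBoundAt`): if every non-CM globally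
minimal `W` additive of class Gss2 at `3` with `r_an(W) ≤ 1` satisfies `Typed.MissingLowerBoundAt W 3`, and
likewise every non-CM globally minimal `V` with GOOD supersingular reduction at `3` and `r_an(V) ≤ 1`, then the
route crux holds (the partner `V` of a non-CM `W` is non-CM: `RamifiedPairUpperBound.not_hasCM_of_smul_quadraticTwist_eq`).
CONDITIONAL on the two displayed class statements; credits nothing. [cite: Miller2011LMS, §1 and Def. 1.1] -/
theorem ramifiedPairLowerBound_of_missingLowerBoundAt
    (hW : ∀ (W : WeierstrassCurve ℚ) [W.IsElliptic] [W.IsGloballyMinimal],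
      ¬ W.HasCM → Addv W 3 → SubGss W 3 → W.analyticRank ≤ 1 → MissingLowerBoundAt W 3)
    (hV : ∀ (V : WeierstrassCurve ℚ) [V.IsElliptic] [V.IsGloballyMinimal],
      ¬ V.HasCM → GoodSS V 3 → V.analyticRank ≤ 1 → MissingLowerBoundAt V 3) :
    RamifiedPairLowerBound := by
  intro W _ _ V _ _ d hCM hadd hsub hd _hv _hsq hC hss hsum
  have hrW : W.analyticRank ≤ 1 := by omega
  have hrV : V.analyticRank ≤ 1 := by omega
  obtain ⟨C, hC⟩ := hC
  have hd0 : (d : ℚ) ≠ 0 := by exact_mod_cast hd.ne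
  have hCMV : ¬ V.HasCM := RamifiedPairUpperBound.not_hasCM_of_smul_quadraticTwist_eq hd0 hC hCM
  exact pairLowerBoundAt_of_missingLowerBoundAt W V (hW W hCM hadd hsub hrW) (hV V hCMV hss hrV)

/-! ## §2 The orientation split (composition of skeleton v3) -/

/-- **X1 BY NAME from the three lower halves (L₀), (L₁), (L_V)** — the composition of the line's skeleton v3:
(L₀) the lower half at `3` on the non-CM Gss2 leaf in analytic rank `0`, (L₁) the same in analytic rank `1`,
(L_V) the lower half at `3` for non-CM good-supersingular-at-`3` curves of analytic rank `≤ 1`. The additive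
member's rank decides which of (L₀)/(L₁) is used (`r_an(W) + r_an(V) = 1`). CONDITIONAL; credits nothing.
[cite: Miller2011LMS, §1 and Def. 1.1] -/
theorem ramifiedPairLowerBound_of_gssLowerHalves
    (h0 : ∀ (W : WeierstrassCurve ℚ) [W.IsElliptic] [W.IsGloballyMinimal],
      ¬ W.HasCM → Addv W 3 → SubGss W 3 → W.analyticRank = 0 → MissingLowerBoundAt W 3)
    (h1 : ∀ (W : WeierstrassCurve ℚ) [W.IsElliptic] [W.IsGloballyMinimal],
      ¬ W.HasCM → Addv W 3 → SubGss W 3 → W.analyticRank = 1 → MissingLowerBoundAt W 3)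
    (hV : ∀ (V : WeierstrassCurve ℚ) [V.IsElliptic] [V.IsGloballyMinimal],
      ¬ V.HasCM → GoodSS V 3 → V.analyticRank ≤ 1 → MissingLowerBoundAt V 3) :
    RamifiedPairLowerBound := by
  refine ramifiedPairLowerBound_of_missingLowerBoundAt (fun W _ _ hCM hadd hsub hr ↦ ?_) hV
  rcases Nat.le_one_iff_eq_zero_or_eq_one.mp hr with hr0 | hr1
  · exact h0 W hCM hadd hsub hr0
  · exact h1 W hCM hadd hsub hr1

/-- **(L_V) is half of the route's own residual.** The route item `GoodSupersingularAtThree`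
(stmt-BirchSwinnertonDyer-23193: `BSD₃(V)` for every non-CM globally minimal `V` good supersingular at `3` with
`r_an(V) ≤ 1`, DECLARED residual and bound as `hR` in `closes`) together with Gross–Zagier–Kolyvagin (`hGZK`, the
route's `PublishedInputGZK`, for the finiteness of `Ш(V)`) gives the lower half for the partner:
`Typed.missingPPartAt_of_bsdp` then `Typed.lower_and_upper_of_missingPPartAt`. CONDITIONAL on the two displayed
inputs; credits nothing. [cite: Miller2011LMS, §1 and Def. 1.1] [cite: Darmon2004, Thm. 3.22] -/
theorem goodSSLowerAtThree_of_goodSupersingularAtThree (hGZK : rank_eq_analyticRank_of_analyticRank_le_one)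
    (hR : GoodSupersingularAtThree) :
    ∀ (V : WeierstrassCurve ℚ) [V.IsElliptic] [V.IsGloballyMinimal],
      ¬ V.HasCM → GoodSS V 3 → V.analyticRank ≤ 1 → MissingLowerBoundAt V 3 := by
  intro V _ _ hCM hss hr
  haveI : Fact (Nat.Prime 3) := ⟨Nat.prime_three⟩
  haveI : Finite V.sha := (hGZK V hr).2
  exact (lower_and_upper_of_missingPPartAt V 3 (missingPPartAt_of_bsdp V 3 (hR V hCM hss hr))).1

/-- **X1 BY NAME from (L₀), (L₁), GZK and the route's residual `GoodSupersingularAtThree`.** Inside the route's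
assembly (`closes` binds `hP : PublishedInputGZK` and `hR : GoodSupersingularAtThree`) the deciding crux therefore
reduces to the two lower halves (L₀), (L₁) of the ADDITIVE member over `ℚ`. CONDITIONAL; credits nothing; (L₀) and
(L₁) are open as ∀-statements (module docstring). [cite: Miller2011LMS, §1 and Def. 1.1] [cite: Darmon2004, Thm. 3.22] -/
theorem ramifiedPairLowerBound_of_gssLowerHalves_of_goodSupersingularAtThree
    (hGZK : rank_eq_analyticRank_of_analyticRank_le_one) (hR : GoodSupersingularAtThree)
    (h0 : ∀ (W : WeierstrassCurve ℚ) [W.IsElliptic] [W.IsGloballyMinimal],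
      ¬ W.HasCM → Addv W 3 → SubGss W 3 → W.analyticRank = 0 → MissingLowerBoundAt W 3)
    (h1 : ∀ (W : WeierstrassCurve ℚ) [W.IsElliptic] [W.IsGloballyMinimal],
      ¬ W.HasCM → Addv W 3 → SubGss W 3 → W.analyticRank = 1 → MissingLowerBoundAt W 3) :
    RamifiedPairLowerBound :=
  ramifiedPairLowerBound_of_gssLowerHalves h0 h1 (goodSSLowerAtThree_of_goodSupersingularAtThree hGZK hR)

/-- The same with the published input and the residual taken BY NAME as the route's items `PublishedInputGZK`
(stmt-BirchSwinnertonDyer-19921) and `GoodSupersingularAtThree` (stmt-BirchSwinnertonDyer-23193).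
[cite: Miller2011LMS, §1 and Def. 1.1] -/
theorem ramifiedPairLowerBound_of_gssLowerHalves_of_items (hP : PublishedInputGZK) (hR : GoodSupersingularAtThree)
    (h0 : ∀ (W : WeierstrassCurve ℚ) [W.IsElliptic] [W.IsGloballyMinimal],
      ¬ W.HasCM → Addv W 3 → SubGss W 3 → W.analyticRank = 0 → MissingLowerBoundAt W 3)
    (h1 : ∀ (W : WeierstrassCurve ℚ) [W.IsElliptic] [W.IsGloballyMinimal],
      ¬ W.HasCM → Addv W 3 → SubGss W 3 → W.analyticRank = 1 → MissingLowerBoundAt W 3) :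
    RamifiedPairLowerBound :=
  ramifiedPairLowerBound_of_gssLowerHalves_of_goodSupersingularAtThree hP hR h0 h1

/-! ## §3 Cassels transport: the lower halves from the INTRINSIC Gss2 classes -/

/-- **The Gss2 lower half at `3` in analytic rank `r ≤ 1` from its INTRINSIC rows.** Inputs: Cassels' isogeny
invariance of the BSD quotient (`hCassels`), GZK (`hGZK`), modularity as analytic continuation (`hmod`) — named
published facts — and `hintr`: the lower half on the non-CM Gss2 curves of analytic rank `r` ALL of whose globally
minimal `ℚ`-isogenous members `W'` have `ord₃ #Ш_an(W') > 0` whenever `#Ш_an(W')` is rational. Every other row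
has a unit member `W'`, where the lower half is free (`ord₃ #Ш(W') ≥ 0`), and Cassels' transport along the class
in analytic rank `≤ 1` (`TwistComparison.missingLowerBoundAt_of_isIsogenous`, with `r_an(W') = r_an(W)` by
`analyticRank_eq_of_isIsogenous'`) carries it to `W`. Census reading
(N < 5·10⁵, instrument only): 366 of 705 classes are intrinsic in rank `0`, 9 of 355 in rank `1`. CONDITIONAL;
the ∀-statement on the intrinsic rows is open; nothing booked. [cite: MilneADT2006, Thm. I.7.3]
[cite: Cassels1965ArithmeticVIII] [cite: Miller2011LMS, Def. 1.1] -/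
theorem gssLowerAtThree_of_intrinsicRows (r : ℕ) (hr1 : r ≤ 1) (hCassels : bsdRHS_eq_of_isIsogenous)
    (hGZK : rank_eq_analyticRank_of_analyticRank_le_one) (hmod : hasEntireLFunction_rat)
    (hintr : ∀ (W : WeierstrassCurve ℚ) [W.IsElliptic] [W.IsGloballyMinimal],
      ¬ W.HasCM → Addv W 3 → SubGss W 3 → W.analyticRank = r →
      (∀ (W' : WeierstrassCurve ℚ) [W'.IsElliptic] [W'.IsGloballyMinimal], IsIsogenous W W' →
        ∀ q' : ℚ, shaAn W' = (q' : ℂ) → 0 < padicValRat 3 q') →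
      MissingLowerBoundAt W 3) :
    ∀ (W : WeierstrassCurve ℚ) [W.IsElliptic] [W.IsGloballyMinimal],
      ¬ W.HasCM → Addv W 3 → SubGss W 3 → W.analyticRank = r → MissingLowerBoundAt W 3 := by
  intro W _ _ hcm hadd hG hr
  haveI : Fact (Nat.Prime 3) := ⟨Nat.prime_three⟩
  by_cases hunit : ∃ (W' : WeierstrassCurve ℚ) (_ : W'.IsElliptic) (_ : W'.IsGloballyMinimal),
      IsIsogenous W W' ∧ ∃ q' : ℚ, shaAn W' = (q' : ℂ) ∧ padicValRat 3 q' ≤ 0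
  · obtain ⟨W', hW', hM', hiso, q', hq', hv'⟩ := hunit
    haveI := hW'
    haveI := hM'
    have hr' : W'.analyticRank ≤ 1 := by rw [← analyticRank_eq_of_isIsogenous' hiso]; omega
    -- free at the unit member `W'` (`ord₃ #Ш(W') ≥ 0`), then Cassels' transport `W' ⟶ W`
    exact TwistComparison.missingLowerBoundAt_of_isIsogenous W' W 3 hCassels hGZK hmod hiso.symm_of_charZero hr'
      ⟨q', hq', hv'.trans (by positivity)⟩
  · refine hintr W hcm hadd hG hr fun W' _ _ hiso q' hq' ↦ ?_
    by_contra hle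
    exact hunit ⟨W', inferInstance, inferInstance, hiso, q', hq', not_lt.mp hle⟩

/-- **X1 BY NAME from the INTRINSIC Gss2 rows at `3` in both ranks, GZK, Cassels, modularity and the route's
residual `GoodSupersingularAtThree`.** This is where the content of the deciding crux lives in the census window:
the rank-`0` intrinsic rows `hintr0` (366 classes of record; Kato's main conjecture at an additive `3`, announced
only on the Fouquet–Wan locus) and the rank-`1` intrinsic rows `hintr1` (9 classes of record, numerical `#Ш_an = 9`;
per-class road: exhibit `(ℤ/3)² ⊆ Ш(E)` by a `3`-descent; class-wide: no `3`-adic Gross–Zagier formula at an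
additive prime is in print). CONDITIONAL; credits nothing; the item stays open. [cite: MilneADT2006, Thm. I.7.3]
[cite: Miller2011LMS, Def. 1.1] [cite: Darmon2004, Thm. 3.22] -/
theorem ramifiedPairLowerBound_of_intrinsicRows_of_goodSupersingularAtThree
    (hCassels : bsdRHS_eq_of_isIsogenous) (hGZK : rank_eq_analyticRank_of_analyticRank_le_one)
    (hmod : hasEntireLFunction_rat) (hR : GoodSupersingularAtThree)
    (hintr0 : ∀ (W : WeierstrassCurve ℚ) [W.IsElliptic] [W.IsGloballyMinimal],
      ¬ W.HasCM → Addv W 3 → SubGss W 3 → W.analyticRank = 0 →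
      (∀ (W' : WeierstrassCurve ℚ) [W'.IsElliptic] [W'.IsGloballyMinimal], IsIsogenous W W' →
        ∀ q' : ℚ, shaAn W' = (q' : ℂ) → 0 < padicValRat 3 q') →
      MissingLowerBoundAt W 3)
    (hintr1 : ∀ (W : WeierstrassCurve ℚ) [W.IsElliptic] [W.IsGloballyMinimal],
      ¬ W.HasCM → Addv W 3 → SubGss W 3 → W.analyticRank = 1 →
      (∀ (W' : WeierstrassCurve ℚ) [W'.IsElliptic] [W'.IsGloballyMinimal], IsIsogenous W W' →
        ∀ q' : ℚ, shaAn W' = (q' : ℂ) → 0 < padicValRat 3 q') →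
      MissingLowerBoundAt W 3) :
    RamifiedPairLowerBound :=
  ramifiedPairLowerBound_of_gssLowerHalves_of_goodSupersingularAtThree hGZK hR
    (gssLowerAtThree_of_intrinsicRows 0 zero_le_one hCassels hGZK hmod hintr0)
    (gssLowerAtThree_of_intrinsicRows 1 le_rfl hCassels hGZK hmod hintr1)

/-! ## §4 Losslessness: X1 and the partner's `BSD₃` give back the lower half of the additive member -/

/-- **Pointwise converse.** If X1's conclusion holds at `(W, V)` and the partner satisfies `BSD₃` EXACTLY at `3`
(`Typed.MissingPPartAt V 3`: `ord₃ #Ш_an(V) = ord₃ #Ш(V)`), then `Typed.MissingLowerBoundAt W 3` (the rationals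
are identified through `Ш_an(V)` by `exact_mod_cast`). [folklore] -/
theorem missingLowerBoundAt_of_pairLowerBoundAt_of_missingPPartAt (W V : WeierstrassCurve ℚ) [W.IsElliptic]
    [V.IsElliptic]
    (h : ∃ q q' : ℚ, shaAn W = (q : ℂ) ∧ shaAn V = (q' : ℂ) ∧
      padicValRat 3 q + padicValRat 3 q' ≤ (padicValNat 3 W.shaOrder : ℤ) + (padicValNat 3 V.shaOrder : ℤ))
    (hV : MissingPPartAt V 3) : MissingLowerBoundAt W 3 := by
  obtain ⟨q, q', hq, hq', hle⟩ := h
  obtain ⟨q'', hq'', hv''⟩ := hV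
  have e : q'' = q' := by exact_mod_cast hq''.symm.trans hq'
  subst e
  exact ⟨q, hq, by linarith⟩

/-- **The reshape is LOSSLESS modulo the route's own items.** X1 (`hL`), the ramified twist supply (the ∀-body of
the route's support `RamifiedTwistSupply`, item 23194 / 25113: every non-CM Gss2 curve with `r_an ≤ 1` has a
3-ramified good-supersingular partner of complementary analytic rank; CLOSED modulo the displayed print inputs
25112 by `ramifiedTwistSupplyOfPub_proof`), `BSD₃` of the partner (the residual `GoodSupersingularAtThree`, `hR`)
and GZK (`hGZK`) give the lower half `Typed.MissingLowerBoundAt W 3` on the WHOLE non-CM Gss2 leaf with `r_an ≤ 1`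
— i.e. (L₀) ∧ (L₁) of §2. So §2's split loses nothing the route does not already display. CONDITIONAL; credits
nothing. [cite: Miller2011LMS, §1 and Def. 1.1] [cite: Darmon2004, Thm. 3.22] -/
theorem gssLowerAtThree_of_ramifiedPairLowerBound (hGZK : rank_eq_analyticRank_of_analyticRank_le_one)
    (hS : RamifiedTwistSupply) (hR : GoodSupersingularAtThree) (hL : RamifiedPairLowerBound) :
    ∀ (W : WeierstrassCurve ℚ) [W.IsElliptic] [W.IsGloballyMinimal],
      ¬ W.HasCM → Addv W 3 → SubGss W 3 → W.analyticRank ≤ 1 → MissingLowerBoundAt W 3 := by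
  intro W _ _ hCM hadd hsub hr
  haveI : Fact (Nat.Prime 3) := ⟨Nat.prime_three⟩
  obtain ⟨d, V, _, _, hd, hv, hsq, hC, hCMV, hss, hsum⟩ := hS W hCM hadd hsub hr
  have hrV : V.analyticRank ≤ 1 := by omega
  haveI : Finite V.sha := (hGZK V hrV).2
  exact missingLowerBoundAt_of_pairLowerBoundAt_of_missingPPartAt W V
    (hL W V d hCM hadd hsub hd hv hsq hC hss hsum) (missingPPartAt_of_bsdp V 3 (hR V hCMV hss hrV))

end Summit.BirchSwinnertonDyer.BirchSwinnertonDyer.Theorems.RamifiedPairLowerBound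

end
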